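import Literature.Analysis.FluidPDE.NSLerayExistenceR3Holds
import Summits.NavierStokesRegularity.NavierStokesRegularity.Theorems.CertifiedBlowupCertifiedBlowupAxisymBlowupKatoLifespan
import Summits.NavierStokesRegularity.NavierStokesRegularity.Theorems.CertifiedBlowupCertifiedBlowupAxisymBlowupBlowupSet
import Summits.NavierStokesRegularity.NavierStokesRegularity.Theorems.CertifiedBlowupCertifiedBlowupAxisymBlowupAmplificationOfKato
import HarnessLib

/-!
# The crux `CertifiedBlowupAxisymBlowup` (stmt-NavierStokesRegularity-0727) in the weak
# (Leray–Hopf / Caffarelli–Kohn–Nirenberg) formulation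

Theorems file landed `--supports stmt-NavierStokesRegularity-0727`, line `compact-amplification`
(continuation lead c3, wave 3). The crux is stated for CLASSICAL solutions: a maximal smooth
solution `(u, p)` of finite lifespan `T` of the unforced Navier–Stokes system (`ν > 0`), Leray–Hopf
on `[0, T]` from its rapidly decaying axisymmetric datum `u 0`. Partial-regularity theory speaks of
GLOBAL Leray–Hopf WEAK solutions and their singular points (`IsRegularPoint U z`: `U` essentially
bounded on some centred parabolic cylinder `Q*_r(z)`). This file proves that the two formulations
coincide on the axisymmetric Schwartz class:

* `ae_eq_of_isLerayHopfOn_of_lerayHopf_classical` — a Leray–Hopf weak solution from the datum of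
  a classical Leray–Hopf solution from a rapidly decaying axisymmetric datum agrees with it a.e. on
  every slice of positive time and a.e. on the open strip `(0, T) × ℝ³` (Prodi–Serrin
  weak–strong uniqueness on every `[0, T']`, `T' < T`, the classical solution being bounded there,
  and Fubini);
* `not_isRegularPoint_of_not_isBoundedNearTop` — hence every point `(T, x₀)` of the blow-up set of
  the witness is a CKN-singular point of the weak solution (an essential bound on `Q*_r(T, x₀)`
  would transfer to the continuous `u` on a backward parabolic neighbourhood of `(T, x₀)`);
* `isRegularPoint_of_katoMaximalTime_eq_top` — conversely, if the Kato maximal time of a smooth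
  divergence-free rapidly decaying datum is infinite, every global Leray–Hopf weak solution from it
  is regular at every point of positive time (it agrees a.e. with the bounded Tao-class developments
  of the datum, again by weak–strong uniqueness);
* `certifiedBlowupAxisymBlowup_iff_exists_singular_lerayHopf` (registered stub) — the crux holds
  iff some `ν > 0` and some smooth, divergence-free, rapidly decaying, axisymmetric datum admit a
  global Leray–Hopf weak solution with a singular point at a positive time (`→`: Leray's existence
  theorem `leray_existence_R3_holds` and the nonempty blow-up set of a witness; `←`: the Kato-lifespan
  form of the crux, `certifiedBlowupAxisymBlowup_iff_exists_katoMaximalTime_lt_top`).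

No new definitions, no named-fact hypotheses, no `sorry`.

## References

* J. Leray, *Sur le mouvement d'un liquide visqueux emplissant l'espace*, Acta Math. 63 (1934),
  §§31–34. [Leray1934]
* L. Caffarelli, R. Kohn, L. Nirenberg, Comm. Pure Appl. Math. 35 (1982), §6.
  [CaffarelliKohnNirenberg1982]
* G. Prodi, Ann. Mat. Pura Appl. 48 (1959). [Prodi1959]
* J. Serrin, in *Nonlinear Problems* (1963). [Serrin1963]
* P. G. Lemarié-Rieusset, *The Navier–Stokes Problem in the 21st Century*, CRC 2016, Prop. 12.3,
  Thm. 15.1. [LemarieRieusset2016]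
* J. C. Robinson, J. L. Rodrigo, W. Sadowski, *The Three-Dimensional Navier–Stokes Equations*,
  CUP 2016, Thm. 8.19. [RobinsonRodrigoSadowski2016]
-/

set_option linter.dupNamespace false

noncomputable section

open MeasureTheory Set Function Filter Topology Metric
open scoped ENNReal NNReal ContDiff

namespace Summit.NavierStokesRegularity.NavierStokesRegularity.Theorems.CertifiedBlowupAxisymBlowup.CompactAmplification

open Literature.Analysis.FluidPDE

section Witness

variable {ν T : ℝ} {u : ℝ → EuclideanSpace ℝ (Fin 3) → EuclideanSpace ℝ (Fin 3)}
  {p : ℝ → EuclideanSpace ℝ (Fin 3) → ℝ}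

/-- **A Leray–Hopf weak solution from the datum of a classical Leray–Hopf solution agrees with it
a.e. on the open strip.** Let `(u, p)` be classical on `[0, T)`, Leray–Hopf on `[0, T]` from its
rapidly decaying axisymmetric datum `u 0`, and let `U` be any Leray–Hopf weak solution on `[0, T]`
from `u 0`. Then `U s = u s` a.e. for every `s ∈ (0, T)` — Prodi–Serrin weak–strong uniqueness
(`weak_strong_uniqueness_holds`, Serrin class `L^∞_t L^∞_x`) on `[0, T']`, `s < T' < T`, where `u`
is bounded (`bounded_before_of_lerayHopf_classical`) — and hence `U = u` a.e. on `(0, T) × ℝ³`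
(Fubini, `ae_restrict_prod_of_forall_ae_eq`). [cite: RobinsonRodrigoSadowski2016, Thm. 8.19] -/
theorem ae_eq_of_isLerayHopfOn_of_lerayHopf_classical (hν : 0 < ν)
    (hcl : IsClassicalNSSolutionOn (Ico 0 T) ν 0 u p) (hLH : IsLerayHopfOn T ν 0 (u 0) u)
    (hdec : HasRapidSpatialDecay (u 0)) (haxi : IsAxisymmetric (u 0))
    {U : ℝ → EuclideanSpace ℝ (Fin 3) → EuclideanSpace ℝ (Fin 3)} (hU : IsLerayHopfOn T ν 0 (u 0) U) :
    (∀ s ∈ Ioo 0 T, U s =ᵐ[volume] u s) ∧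
      uncurry U =ᵐ[volume.restrict (Ioo 0 T ×ˢ univ)] uncurry u := by
  have hae : ∀ s ∈ Ioo 0 T, U s =ᵐ[volume] u s := by
    intro s hs
    set T' : ℝ := (s + T) / 2 with hT'_def
    have hsT' : s < T' := by rw [hT'_def]; linarith [hs.2]
    have hT'T : T' < T := by rw [hT'_def]; linarith [hs.2]
    have hT'0 : 0 < T' := hs.1.trans hsT'
    obtain ⟨M, hM⟩ := bounded_before_of_lerayHopf_classical hν hcl hLH hdec haxi T' hT'T
    have hSer : MemLqLp ⊤ ⊤ u (Ioo 0 T') :=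
      memLqLp_top_top_of_bound
        (fun r hr => (hcl.contDiff_velocity ⟨hr.1, hr.2.trans_lt hT'T⟩).continuous.aestronglyMeasurable)
        hM
    have hLHu : IsLerayHopfOn T' ν 0 (u 0) u := IsLerayHopfOn.mono_holds hLH hT'T.le
    have hLHU : IsLerayHopfOn T' ν 0 (u 0) U := IsLerayHopfOn.mono_holds hU hT'T.le
    exact weak_strong_uniqueness_holds hν hT'0 hLHu (q := ⊤) (r := ⊤) ENNReal.ofNat_lt_top
      (by simp [ENNReal.div_top]) hSer hLHU s ⟨hs.1, hsT'.le⟩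
  have hum : AEStronglyMeasurable (uncurry u) (volume.restrict (Ioo 0 T ×ˢ univ)) :=
    (hcl.smooth_velocity.continuousOn.mono
      (prod_mono Ioo_subset_Ico_self Subset.rfl)).aestronglyMeasurable
      (measurableSet_Ioo.prod MeasurableSet.univ)
  exact ⟨hae, ae_restrict_prod_of_forall_ae_eq hae hU.weak.1 hum⟩

/-- **Points of the blow-up set of a classical Leray–Hopf solution are singular points of every
Leray–Hopf weak solution from its datum.** In the setting of
`ae_eq_of_isLerayHopfOn_of_lerayHopf_classical` (`0 < T`), if `u` is unbounded on every backward
parabolic neighbourhood of `(T, x₀)` then `(T, x₀)` is not a regular point of `U`: an essential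
bound `K` for `U` on a centred cylinder `Q*_r(T, x₀)` is an a.e. bound for `u` on the open backward
part `(T - ρ², T) × B(x₀, ρ)`, `ρ = min r √T` (where `U = u` a.e.), hence an everywhere bound by
continuity of `u` on `[0, T) × ℝ³` (`SereginSverak2009.forall_le_of_ae_le_of_continuousOn`).
[cite: CaffarelliKohnNirenberg1982, §6] -/
theorem not_isRegularPoint_of_not_isBoundedNearTop (hν : 0 < ν) (hT : 0 < T)
    (hcl : IsClassicalNSSolutionOn (Ico 0 T) ν 0 u p) (hLH : IsLerayHopfOn T ν 0 (u 0) u)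
    (hdec : HasRapidSpatialDecay (u 0)) (haxi : IsAxisymmetric (u 0))
    {U : ℝ → EuclideanSpace ℝ (Fin 3) → EuclideanSpace ℝ (Fin 3)} (hU : IsLerayHopfOn T ν 0 (u 0) U)
    {x₀ : EuclideanSpace ℝ (Fin 3)} (hx₀ : ¬ IsBoundedNearTop u T x₀) :
    ¬ IsRegularPoint U (T, x₀) := by
  rintro ⟨r, hr, hfin⟩
  obtain ⟨-, hae⟩ := ae_eq_of_isLerayHopfOn_of_lerayHopf_classical hν hcl hLH hdec haxi hU
  -- the essential bound of `U` on the centred cylinder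
  set Q : Set (ℝ × EuclideanSpace ℝ (Fin 3)) := parabolicCylinderCentered r ((T : ℝ), x₀) with hQ_def
  set K : ℝ := (eLpNorm (uncurry U) ∞ (volume.restrict Q)).toReal with hK_def
  have hKae : ∀ᵐ z ∂(volume.restrict Q), ‖uncurry U z‖ ≤ K := by
    filter_upwards [ae_le_eLpNormEssSup (μ := volume.restrict Q) (f := uncurry U)] with z hz
    rw [eLpNorm_exponent_top] at hfin
    have h := ENNReal.toReal_mono hfin.ne hz
    rw [toReal_enorm] at h
    rw [hK_def, eLpNorm_exponent_top]
    exact h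
  -- the open backward part `W = (T - ρ², T) × B(x₀, ρ)`, `ρ = min r √T`
  set ρ : ℝ := min r (Real.sqrt T) with hρ_def
  have hρ0 : 0 < ρ := lt_min hr (Real.sqrt_pos.2 hT)
  have hρr : ρ ≤ r := min_le_left _ _
  have hρT : ρ ^ 2 ≤ T := by
    calc ρ ^ 2 ≤ Real.sqrt T ^ 2 := pow_le_pow_left₀ hρ0.le (min_le_right _ _) 2
      _ = T := Real.sq_sqrt hT.le
  have hρr2 : ρ ^ 2 ≤ r ^ 2 := pow_le_pow_left₀ hρ0.le hρr 2
  set W : Set (ℝ × EuclideanSpace ℝ (Fin 3)) := Ioo (T - ρ ^ 2) T ×ˢ ball x₀ ρ with hW_def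
  have hWopen : IsOpen W := isOpen_Ioo.prod isOpen_ball
  have hWQ : W ⊆ Q := by
    rintro ⟨s, y⟩ ⟨hs, hy⟩
    rw [hQ_def, mem_parabolicCylinderCentered]
    refine ⟨⟨by linarith [hs.1], ?_⟩, mem_ball.1 (ball_subset_ball hρr hy)⟩
    have hr2 : 0 < r ^ 2 := by positivity
    exact hs.2.trans (by linarith)
  have hWstrip : W ⊆ Ioo 0 T ×ˢ (univ : Set (EuclideanSpace ℝ (Fin 3))) :=
    prod_mono (fun s hs => ⟨by linarith [hs.1], hs.2⟩) (subset_univ _)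
  have hWslab : W ⊆ Ico 0 T ×ˢ (univ : Set (EuclideanSpace ℝ (Fin 3))) :=
    hWstrip.trans (prod_mono Ioo_subset_Ico_self Subset.rfl)
  -- `‖u‖ ≤ K` a.e. on `W`, hence everywhere on `W`
  have haeW : ∀ᵐ z ∂(volume.restrict W), ‖uncurry u z‖ ≤ K := by
    filter_upwards [ae_restrict_of_ae_restrict_of_subset hWstrip hae,
      ae_restrict_of_ae_restrict_of_subset hWQ hKae] with z hz hzK
    rw [← hz]
    exact hzK
  have hcont : ContinuousOn (uncurry u) W := hcl.smooth_velocity.continuousOn.mono hWslab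
  have hall := SereginSverak2009.forall_le_of_ae_le_of_continuousOn hWopen hcont.norm
    continuousOn_const haeW
  exact hx₀ ⟨ρ, hρ0, K, fun t ht x hx => hall (t, x) ⟨ht, hx⟩⟩

end Witness

/-- **Infinite Kato maximal time ⇒ every global Leray–Hopf weak solution is regular at positive
times.** Let `u₀` be smooth, divergence free and rapidly decaying with `katoMaximalTime ν u₀ = ∞`
(`ν > 0`), and let `U` be a global Leray–Hopf weak solution from `u₀`. For `t > 0` put `T' = t + 1`:
a Kato solution lives beyond `T'` (`exists_isKatoSolutionOn_of_lt_katoMaximalTime`) and upgrades to a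
Tao-class solution `V` on `[0, T']` (von Wahl, `exists_isTaoSolutionOn_of_isKatoSolutionOn`), bounded
by some `B` and Leray–Hopf; by Prodi–Serrin (`weak_strong_uniqueness_holds`) `U s = V s` a.e. for
`s ∈ (0, T']`, so `‖U‖ ≤ B` a.e. on `(0, T') × ℝ³` (Fubini), in particular on the centred cylinder
`Q*_r(t, x)`, `r = min 1 √t`. [cite: LemarieRieusset2016, Prop. 12.3 and Thm. 15.1] -/
theorem isRegularPoint_of_katoMaximalTime_eq_top {ν : ℝ} (hν : 0 < ν)
    {u₀ : EuclideanSpace ℝ (Fin 3) → EuclideanSpace ℝ (Fin 3)} (hsm : ContDiff ℝ ∞ u₀)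
    (hdiv : VectorCalculus.IsDivFree u₀) (hdec : HasRapidSpatialDecay u₀)
    (htop : katoMaximalTime ν u₀ = ⊤)
    {U : ℝ → EuclideanSpace ℝ (Fin 3) → EuclideanSpace ℝ (Fin 3)} (hU : IsGlobalLerayHopf ν 0 u₀ U)
    {t : ℝ} (ht : 0 < t) (x : EuclideanSpace ℝ (Fin 3)) : IsRegularPoint U (t, x) := by
  have hdivW : NSWave0.IsDivFree u₀ := fun y => hdiv y
  set T' : ℝ := t + 1 with hT'_def
  have hT'0 : 0 < T' := by rw [hT'_def]; linarith
  have hlt : ENNReal.ofReal T' < katoMaximalTime ν u₀ := by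
    rw [htop]; exact ENNReal.ofReal_lt_top
  obtain ⟨T'', hT'T'', w, hw⟩ := exists_isKatoSolutionOn_of_lt_katoMaximalTime hlt
  have hTT : T' < T'' := (ENNReal.ofReal_lt_ofReal_iff'.1 hT'T'').1
  obtain ⟨V, Q, hV⟩ := exists_isTaoSolutionOn_of_isKatoSolutionOn hν hsm hdivW hdec hw hT'0 hTT
  obtain ⟨B, -, hB⟩ := hV.exists_bound_velocity
  have hLHV : IsLerayHopfOn T' ν 0 u₀ V := hV.isLerayHopfOn hT'0
  have hSer : MemLqLp ⊤ ⊤ V (Ioo 0 T') :=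
    memLqLp_top_top_of_bound (fun s hs => hV.aestronglyMeasurable_slice hs) hB
  have hLHU : IsLerayHopfOn T' ν 0 u₀ U := hU T' hT'0
  have hae : ∀ s ∈ Ioo 0 T', U s =ᵐ[volume] V s := fun s hs =>
    weak_strong_uniqueness_holds hν hT'0 hLHV (q := ⊤) (r := ⊤) ENNReal.ofNat_lt_top
      (by simp [ENNReal.div_top]) hSer hLHU s ⟨hs.1, hs.2.le⟩
  have hae' : uncurry U =ᵐ[volume.restrict (Ioo 0 T' ×ˢ univ)] uncurry V :=
    ae_restrict_prod_of_forall_ae_eq hae hLHU.weak.1 hV.aestronglyMeasurable_uncurry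
  -- the centred cylinder of radius `r = min 1 √t` at `(t, x)` lies in the strip `(0, T') × ℝ³`
  set r : ℝ := min 1 (Real.sqrt t) with hr_def
  have hr0 : 0 < r := lt_min one_pos (Real.sqrt_pos.2 ht)
  have hr1 : r ^ 2 ≤ 1 := by
    have h1 : r ≤ 1 := min_le_left _ _
    nlinarith [hr0.le]
  have hrt : r ^ 2 ≤ t := by
    calc r ^ 2 ≤ Real.sqrt t ^ 2 := pow_le_pow_left₀ hr0.le (min_le_right _ _) 2
      _ = t := Real.sq_sqrt ht.le
  have hsub : parabolicCylinderCentered r ((t : ℝ), x) ⊆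
      Ioo 0 T' ×ˢ (univ : Set (EuclideanSpace ℝ (Fin 3))) := by
    rintro ⟨s, y⟩ hz
    rw [mem_parabolicCylinderCentered] at hz
    exact ⟨⟨by linarith [hz.1.1], by rw [hT'_def]; linarith [hz.1.2]⟩, mem_univ _⟩
  refine ⟨r, hr0, ?_⟩
  have haeQ : ∀ᵐ z ∂(volume.restrict (parabolicCylinderCentered r ((t : ℝ), x))),
      ‖uncurry U z‖ ≤ B := by
    filter_upwards [ae_restrict_of_ae_restrict_of_subset hsub hae',
      ae_restrict_mem (isOpen_parabolicCylinderCentered r ((t : ℝ), x)).measurableSet] with z hz hzQ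
    rw [hz]
    exact hB z.1 ⟨(hsub hzQ).1.1.le, (hsub hzQ).1.2.le⟩ z.2
  rw [eLpNorm_exponent_top]
  exact eLpNormEssSup_lt_top_of_ae_bound haeQ

/-- **The crux in the weak formulation** (registered stub of stmt-NavierStokesRegularity-0727).
`CertifiedBlowupAxisymBlowup` — some maximal Leray–Hopf classical solution from a rapidly decaying
axisymmetric datum has finite lifespan — holds iff some viscosity `ν > 0` and some smooth,
divergence-free, rapidly decaying, axisymmetric datum `u₀` admit a GLOBAL Leray–Hopf weak solution
`U` with a singular point `(t, x)` in the sense of Caffarelli–Kohn–Nirenberg at a positive time.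
`→`: for a witness `(ν, T, u, p)`, Leray's existence theorem (`leray_existence_R3_holds`) gives a
global weak solution `U` from `u 0`, and every point `x₀` of the nonempty blow-up set of the witness
(`exists_not_isBoundedNearTop_of_isMaximalSmoothSolution`) yields the singular point `(T, x₀)` of `U`
(`not_isRegularPoint_of_not_isBoundedNearTop`). `←`: by the Kato-lifespan form of the crux
(`certifiedBlowupAxisymBlowup_iff_exists_katoMaximalTime_lt_top`) it suffices that
`katoMaximalTime ν u₀ < ∞`, and an infinite Kato maximal time would make `U` regular at every point
of positive time (`isRegularPoint_of_katoMaximalTime_eq_top`).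
[cite: LemarieRieusset2016, Thm. 15.1 and Prop. 12.3] -/
theorem certifiedBlowupAxisymBlowup_iff_exists_singular_lerayHopf :
    Summit.NavierStokesRegularity.NavierStokesRegularity.Theses.CertifiedBlowup.CertifiedBlowupAxisymBlowup ↔
      ∃ ν : ℝ, 0 < ν ∧ ∃ (u₀ : EuclideanSpace ℝ (Fin 3) → EuclideanSpace ℝ (Fin 3))
        (U : ℝ → EuclideanSpace ℝ (Fin 3) → EuclideanSpace ℝ (Fin 3)),
        ContDiff ℝ ∞ u₀ ∧ VectorCalculus.IsDivFree u₀ ∧ HasRapidSpatialDecay u₀ ∧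
          IsAxisymmetric u₀ ∧ IsGlobalLerayHopf ν 0 u₀ U ∧
            ∃ t : ℝ, 0 < t ∧ ∃ x : EuclideanSpace ℝ (Fin 3), ¬ IsRegularPoint U (t, x) := by
  constructor
  · rintro ⟨ν, hν, T, hT, u, p, hmax, hLH, hdec, hax⟩
    have h0T : (0 : ℝ) ∈ Ico 0 T := ⟨le_rfl, hT⟩
    obtain ⟨U, hU⟩ := leray_existence_R3_holds ν hν (u 0) (hLH.memLp 0 ⟨le_rfl, hT.le⟩)
      (hLH.isWeaklyDivFree_datum hT)
    obtain ⟨x₀, hx₀⟩ :=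
      exists_not_isBoundedNearTop_of_isMaximalSmoothSolution hν hT hmax hLH hdec hax
    exact ⟨ν, hν, u 0, U, hmax.1.contDiff_velocity h0T, hmax.1.divFree 0 h0T, hdec, hax, hU, T, hT,
      x₀, not_isRegularPoint_of_not_isBoundedNearTop hν hT hmax.1 hLH hdec hax (hU T hT) hx₀⟩
  · rintro ⟨ν, hν, u₀, U, hsm, hdiv, hdec, hax, hU, t, ht, x, hx⟩
    refine certifiedBlowupAxisymBlowup_iff_exists_katoMaximalTime_lt_top.2
      ⟨ν, hν, u₀, hsm, hdiv, hdec, hax, ?_⟩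
    rw [lt_top_iff_ne_top]
    intro htop
    exact hx (isRegularPoint_of_katoMaximalTime_eq_top hν hsm hdiv hdec htop hU ht x)

end Summit.NavierStokesRegularity.NavierStokesRegularity.Theorems.CertifiedBlowupAxisymBlowup.CompactAmplification

end
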